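import Literature.MathematicalPhysics.QuantumFieldTheory.MagnenRivasseauSeneor1993.MRS93LargeFieldSmallFactor
import Literature.MathematicalPhysics.QuantumFieldTheory.MagnenRivasseauSeneor1993.MRS93ConvergencePowerCounting
import Literature.MathematicalPhysics.QuantumFieldTheory.MagnenRivasseauSeneor1993.MRS93PhaseCells
import Literature.Probability.LatticeModels.PolymerTreeSum
import Literature.Probability.LatticeModels.LocalFactorialBound
import Literature.MathematicalPhysics.QuantumFieldTheory.GaussianLocalFactorials
import HarnessLib

/-!
# Magnen–Rivasseau–Sénéor, *Construction of YM₄ with an infrared cutoff* (CMP 155, 1993), §II.B p.336: «the spatial decrease of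
# the propagator is matched to the shape of the boxes … we obtain a product of local factorials in the number of the fields in each
# box [R]. Therefore for each box Δ we have a factor (λ_i^t)^{ε₁P_i} K^{P_i} (P_i/2)!» — the MATCHING of the sliced-propagator decay
# (II.27)/(VII.1) to the anisotropic boxes `𝐃_{i,α}`, its summability over the box lattice («q equal to 4, so that the propagator is
# summable»), the three inputs of the local factorial principle [R] in the tree's currency, and the power counting
# (II.26)–(II.27) ⟹ left side of (II.28), kernel-checked

elementary real analysis and finite combinatorics (box geometry on `ℤ × ℤ³`, row sums of a product decay, the arithmetic
`√((2m)!) ≤ 2^m m!` and `λ^{1/2+ε₁}M^{−i} · √(2K_qM^{2i}/λ) = λ^{ε₁}√(2K_q)`); nothing here is a claim about the Yang–Mills mass gap,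
about continuum YM₄ on `T⁴` (with or without infrared cutoff), or about the Clay problem — and nothing of MRS's cluster expansion
itself, of Lemma II.1 (a SKETCH in print, completed per the authors by Sect. VI), of the stability estimates or of the main statement
is asserted or upgraded

**Citation header (reproduction of PUBLISHED work).** J. Magnen, V. Rivasseau, R. Sénéor, *Construction of YM₄ with an infrared
cutoff*, Commun. Math. Phys. **155** (1993) 325–383 [MagnenRivasseauSeneor1993]: Sect. II.B pp.335–336 ((II.25)–(II.28), the
boxes `𝐃_{i,α}`, (II.27) and the paragraph after it). The device «[R]» = V. Rivasseau, *From Perturbative to Constructive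
Renormalization*, Princeton UP 1991 [Rivasseau1991], §II.6 Lemma II.6.2 and §III.1 Lemma III.1.2 ∕ (III.1.6) — vendored in the tree as
`Literature.Probability.LatticeModels.LocalFactorialBound` (`LocalFactorial.hafnian_le_localFactorial`, `occ`, `locFact`),
`…PolymerTreeSum` (`PolymerTreeSum.ZLattice.row_sum_le`, `T1`) and `Literature.MathematicalPhysics.QuantumFieldTheory.GaussianLocalFactorials`
(`GaussianLocalFactorial.abs_moment_density_le_localFactorial`). Loci «p.NNN [PDF nn] tl.k» = journal page, PDF page (= journal
page − 324), text-layer line of the held scan `paper:magnen1993-cmp155-mrs-ym4-infrared-cutoff`. Cell pub-balaban-gaps (YM blitz,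
track G3), seat mrs-lit-2 (gen 17, file 45; v1 landed as p392213, EDITION v1.1 = §7–§8 appended, EDITION v1.2 = §9, add-only); companion record `run/shared/lean/pub/pub-balaban-gaps/g3/MRS-AS-PRINTED-estimates.md`.
Siblings whose vocabulary is USED, not re-typed: `…MRS93PhaseCells` (`PhaseCells.anisoBox M i α k`, the boxes of `𝐃_{i,α}` with
lower corner `k ∈ ℤ⁴` in units of the sides `M^{−α}`, `M^{−i}`), `…MRS93LargeFieldSmallFactor` (`LargeField.AxialSliceBound` = (II.27)
for one `q`, `LargeField.localFactorial_le` = the inequality (II.28)), `…MRS93ConvergencePowerCounting` (`Convergence.SliceBound` =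
(VII.1) for one `q`); the estimates (II.27)/(VII.1) themselves are PROVED for MRS's own slices in `…MRS93SlicedPropagatorDecay`
(not imported here: this file consumes them as hypotheses in the predicates' currency, so it applies to any kernel family obeying them).

**What the paper prints (verbatim).**
* p.336 [PDF 12] tl.6–8: *«Remark that the anisotropic nature of C_axial leads to different rates of spatial decay in the zero
  component and the spatial component of x − y. This is the reason for which we must use rectangular boxes with a double index.»*
* p.336 tl.14–16: *«In theory it might be sufficient to take q in (II.27) equal to 4, so that the propagator is summable, but in
  practice we will take it to be large, e.g. 100, in order to have some margin for the convergence of cluster expansions.»*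
* p.336 tl.17–23: *«Using the bound (II.27) we can perform a cluster expansion between the rectangular boxes of the large field
  region Λ_l. Each factor E_Δ contains P_i fields which are integrated with respect to C_axial. As is usual when the spatial decrease
  of the propagator is matched to the shape of the boxes in which the cluster expansion is performed, we obtain a product of local
  factorials in the number of the fields in each box [R]. Therefore for each box Δ we have a factor
  (λ_i^t)^{ε₁P_i} K^{P_i} (P_i/2)! ≤ e^{−(λ_i^t)^{−ε₁/2}} (II.28) if λ_i^t is small enough …»* ((II.26) p.335 tl.23–24: the fields of
  `E_Δ` carry the normalisation `(λ_i^t)^{1/2+ε₁} M^{−i}` each — `PhaseCells.smallFieldE`; p.336 tl.9–10: *«the Gaussian measure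
  corresponding to C_axial gives for a field A^j a typical size M^iλ^{−1/2}»*.)
* p.335 [PDF 11] tl.16–19: *«𝐃_{i,α} is the lattice of boxes of side M^{−i} in the directions 1, 2, 3 and of side M^{−α} in the
  direction 0.»*; (II.27) p.335 tl.34–38: *«C^j_axial(x − y) ≤ (K_q M^{2i}/λ)(1/(1 + |x₀ − y₀|M^α) · 1/(1 + |x⃗ − y⃗|M^i))^q»*.

**What is formalised (every statement below is a `theorem` with its proof; no new predicate taken as hypothesis is introduced).**
* §1–§2 THE MATCHING. Boxes of `𝐃_{i,α}` are `PhaseCells.anisoBox M i α k`, `k ∈ ℤ⁴`; the box-pair weight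
  `boxWeight q k k′ = (1 + |k₀ − k′₀|)^{−q} (1 + max_{j=1,2,3}|k_j − k′_j|)^{−q}` (time label distance `dT`, spatial label
  sup-distance `dS` = `VolumeEffect.ZLattice.supDist 3` of the spatial labels). `decay_le_boxWeight`: for `x ∈ Δ_k`, `y ∈ Δ_{k′}`,
  `(1/(1 + |x₀ − y₀|M^α) · 1/(1 + |x⃗ − y⃗|M^i))^q ≤ 4^q · boxWeight q k k′` (the elementary `one_div_le_two_div`: a point decay at
  rate `s` between two cells of mesh `s⁻¹` is at most twice the label decay, per direction; `|x⃗ − y⃗| ≥ |x_j − y_j|` in the direction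
  attaining the label maximum).
* §3 (II.27) ∕ (VII.1) BETWEEN BOXES: `abs_le_boxWeight_of_axialSliceBound` — `LargeField.AxialSliceBound C M λ q K_q` gives
  `|C i α (x − y)| ≤ (K_q M^{2i}/λ)·4^q·boxWeight q k k′` for `x ∈ Δ_k`, `y ∈ Δ_{k′}`; `abs_le_boxWeight_of_sliceBound` — the same from
  `Convergence.SliceBound` with the rate `K_q M^i M^α` of (VII.1). (`toTS x = (x₀, x⃗)` reads the kernels' argument in `ℝ × ℝ³` off a
  point of `ℝ⁴`.)
* §4 SUMMABILITY («q equal to 4»): `sum_boxWeight_le` — for every natural `q ≥ 4`, every finite set `Λ ⊂ ℤ⁴` of boxes and every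
  box `k`, `Σ_{k′∈Λ} boxWeight q k k′ ≤ 2ζ(q)·(2ζ(q/3))³` (`ζ(s) = Σ'_{m≥0}(1+m)^{−s}` = `PolymerTreeSum.ZLattice.T1 s`), uniformly in
  `Λ`: the label `k′ ↦ (k′₀, k⃗′)` splits the sum into a time sum (`sum_time_le`, `q > 1`) times a space sum over `ℤ³` (`sum_space_le`
  = `row_sum_le` with `d = 3`, `q > 3`). The product form is what makes `q = 4` enough (the isotropic sup-distance on `ℤ⁴` would ask
  `q > 4`).
* §5 THE INPUTS OF [R]: `axialBoxWeight K_q M λ q i = (K_q M^{2i}/λ)·4^q·boxWeight q` with `axialBoxWeight_nonneg` (hypothesis `hw`),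
  `sum_axialBoxWeight_le` (hypothesis `hB`, constant `B = (K_q M^{2i}/λ)·4^q·2ζ(q)(2ζ(q/3))³`), `cov_le_axialBoxWeight` (hypothesis
  `hdom`: fields `n ∈ W` at points `x_n ∈ Δ_{ℓ n}` with `|cov(n,m)| ≤ |C^{i,α}_axial(x_n − x_m)|` have `|cov(n,m)| ≤ w^{i,α}(Δ_{ℓ n}, Δ_{ℓ m})`)
  — exactly the three hypotheses of `GaussianLocalFactorial.abs_moment_density_le_localFactorial` (file
  `…GaussianLocalFactorials`), whose conclusion is the LOCAL FACTORIAL BOUND `|∫∏_nφ(x_n)·F dμ∕Z| ≤ √(2B)^{#W}·∏_{Δ∈Λ}√(N(Δ)!)` for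
  every density `|F| ≤ 1`, `N(Δ) = occ ℓ Δ` the number of fields in the box `Δ`.
* §6 THE POWER COUNTING (II.26)–(II.28): `normalisation_mul_sqrt` — `λ^{1/2+ε₁}M^{−i}·√(2(K_qM^{2i}/λ)R) = λ^{ε₁}√(2K_qR)`;
  `sqrt_factorial_two_mul_le` — `√((2m)!) ≤ 2^m m!`; `pow_card_mul_locFact` — `x^{#W}∏_Δ√(N(Δ)!) = ∏_Δ x^{N(Δ)}√(N(Δ)!)`;
  `box_factor_le` — `(λ^{ε₁}K₀)^{2m}√((2m)!) ≤ λ^{ε₁·2m}(√2K₀)^{2m} m!`; `normalised_le_prod_boxes` — from ANY bound of the local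
  factorial form `X ≤ √(2B)^{#W} locFact ℓ Λ` with `B = (K_qM^{2i}/λ)R`: `c^{#W}·X ≤ ∏_{Δ∈Λ}(λ^{ε₁}K₀)^{N(Δ)}√(N(Δ)!)`,
  `c = λ^{1/2+ε₁}M^{−i}`, `K₀ = √(2K_qR)`; `normalised_le_exp_pow_card` — if every box of `Λ` holds `P = 2m` fields, `2m = λ^{−ε₁/2}`
  and `K λ^{3ε₁/4} ≤ e^{−1}` with `K = √2K₀` (the kernel-checked smallness condition of `LargeField.localFactorial_le`; the print has
  `√K` — see that file's `printedCondition_counterexample`), then `c^{#W}·X ≤ (e^{−λ^{−ε₁/2}})^{#Λ}`: one factor (II.28) per box.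

* §7 (EDITION v1.1) SMEARED FIELDS: `abs_boxAverage_le`, `abs_multiBoxAverage_le` — a bound valid for every choice of one position per
  box passes to the averages `(1/|Δ|)∫_Δ` of (II.26) (Mathlib's `norm_setIntegral_le_of_norm_le_const`); `volume_anisoBox_lt_top`.
* §8 (EDITION v1.1) [R]'s TREE-DECAY BOUND ON ONE ANISOTROPIC LATTICE (Sect. VII p.375 tl.2–5 «given some fixed box we can perform the
  sum over all the boxes linked to it … similar to the case considered in [R]»): `boxWeight_symm` and **`polymerTreeSum_boxWeight_le`** —
  for `q ≥ 4`, every finite `Λ ⊂ 𝐃_{i,α}`, `o ∈ Λ`, `p`: `PolymerTreeSum.polymerTreeSum o w_q p ≤ (8·max 1 (2ζ(q)(2ζ(q/3))³))^p`, uniformly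
  in `Λ` — [R] Lemma III.1.4 (III.1.28) (`PolymerTreeSum.polymerTreeSum_le`, «any summable decay») fed with §4's row sums.

* §9 (EDITION v1.2) THE LOCAL FACTORIAL PRINCIPLE APPLIED: `abs_moment_density_le_localFactorial_boxes` — for the finite-dimensional
  Gaussian measures of `…GaussianLocalFactorials` (precision matrix `A` on `ℝ^S`, fields `φ ⬝ᵥ v_n` at points `x_n ∈ Δ_{ℓ n}` of `𝐃_{i,α}`,
  `|⟨A⁻¹v_n, v_m⟩| ≤ |C^{i,α}_axial(x_n − x_m)|`, (II.27) with `q ≥ 4`) and every measurable density `|F| ≤ 1`: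
  `|∫∏_nφ(v_n)·F dμ∕Z| ≤ √(2B)^{#W}·∏_{Δ∈Λ}√(N(Δ)!)`, `B = (K_qM^{2i}/λ)·4^q·2ζ(q)(2ζ(q/3))³` (§5 fed into
  `GaussianLocalFactorial.abs_moment_density_le_localFactorial`); `abs_normalised_moment_le_exp_pow_card` — with the (II.26)
  normalisation per field, `P_i = 2m` fields per box, `2m = λ^{−ε₁/2}` and `Kλ^{3ε₁/4} ≤ e^{−1}`: `≤ (e^{−λ^{−ε₁/2}})^{#Λ}` (§6 applied).
**Reading conventions.** (i) Points of space-time are `x : Fin 4 → ℝ` (coordinate `0` = time), as in `…MRS93PhaseCells`; the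
kernels of (II.27)/(VII.1) take `x − y ∈ ℝ × ℝ³` (`toTS`), `|x⃗ − y⃗|` Euclidean. (ii) `α : ℕ` as in the predicates (the print allows
`N_i < 0`; not typed there either). (iii) The Gaussian integration «with respect to C_axial» enters §5–§6 only through a covariance
table `cov : W → W → ℝ` dominated by the sliced kernel at the fields' positions and through the local-factorial-form hypothesis `hX`;
the finite-dimensional Gaussian measures for which the tree PROVES `hX` from §5 are those of `…GaussianLocalFactorials` (precision
matrix `A` on `ℝ^S`, fields `φ ⬝ᵥ v_n`) — §9 carries this application out. Fields smeared over their box (the averages `(1/|Δ|)∫_Δ` of (II.26)) are covered position by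
position (§7 makes the passage to the averages explicit). (iv) `K` «some constant» is made explicit: `K = 2√(K_q·4^q·2ζ(q)(2ζ(q/3))³)` (i.e. `R = 4^q·2ζ(q)(2ζ(q/3))³` in §6), depending on
`q` and `K_q` only — not on `i`, `α`, `M`, `λ`, `Λ`.

**What is NOT claimed.** The cluster expansion between the boxes of the large field region, the treatment of the interpolated
covariances, the positive factor `χ(Δ, ρ²Δ)`, the counterterms and the normalizing determinant (p.336 tl.25–37), Lemma II.1, Lemma
VI.1, or any statement about `C_axial` beyond the displayed (II.27) taken as hypothesis. Nothing here bears on Bałaban's papers.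
-/

noncomputable section

open Finset MeasureTheory Matrix Set

namespace Literature.MathematicalPhysics.QuantumFieldTheory.MagnenRivasseauSeneor1993

namespace BoxMatchedDecay

open Literature.Probability.LatticeModels.VolumeEffect.ZLattice (supDist)
open Literature.Probability.LatticeModels.PolymerTreeSum.ZLattice (T1 row_sum_le)
open PhaseCells (anisoBox boxSide)
open Literature.Probability.LatticeModels.LocalFactorial (occ locFact)
open scoped Nat

/-! ## §1 One-dimensional matching: point decay at rate `s` versus the labels of the lattice of side `s⁻¹` -/

/-- **The elementary matching inequality.** If `t` lies in the cell `[a s⁻¹, (a+1) s⁻¹]` and `y` in the cell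
`[a′ s⁻¹, (a′+1) s⁻¹]` of the one-dimensional lattice of mesh `s⁻¹` (written multiplicatively: `a ≤ ts ≤ a + 1`,
`a′ ≤ ys ≤ a′ + 1`), and `|t − y| ≤ u`, then `1/(1 + u·s) ≤ 2/(1 + |a − a′|)`: the decay factor of (II.27) at rate `s`
between points is at most twice the same factor between the integer labels. [folklore] -/
private theorem one_div_le_two_div {s t y u : ℝ} (hs : 0 < s) {a a' : ℤ} (ha : (a : ℝ) ≤ t * s) (ha' : t * s ≤ a + 1)
    (hb : (a' : ℝ) ≤ y * s) (hb' : y * s ≤ a' + 1) (hu : |t - y| ≤ u) :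
    1 / (1 + u * s) ≤ 2 / (1 + ((a - a').natAbs : ℝ)) := by
  have hcast : (((a - a').natAbs : ℝ)) = |((a : ℝ)) - (a' : ℝ)| := by
    rw [Nat.cast_natAbs, Int.cast_abs, Int.cast_sub]
  have h1 : |((a : ℝ)) - (a' : ℝ)| ≤ |t * s - y * s| + 1 := by
    rcases le_total ((a : ℝ)) (a' : ℝ) with hle | hle
    · rw [abs_of_nonpos (sub_nonpos.2 hle)]
      have : y * s - t * s ≤ |t * s - y * s| := by rw [abs_sub_comm]; exact le_abs_self _
      linarith
    · rw [abs_of_nonneg (sub_nonneg.2 hle)]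
      have : t * s - y * s ≤ |t * s - y * s| := le_abs_self _
      linarith
  have h2 : |t * s - y * s| = |t - y| * s := by
    rw [← sub_mul, abs_mul, abs_of_pos hs]
  have h3 : |t - y| * s ≤ u * s := mul_le_mul_of_nonneg_right hu hs.le
  have hu0 : 0 ≤ u := (abs_nonneg _).trans hu
  have hkey : 1 + ((a - a').natAbs : ℝ) ≤ 2 * (1 + u * s) := by
    rw [hcast]; nlinarith
  rw [div_le_div_iff₀ (by positivity) (by positivity), one_mul]
  linarith

/-- Membership in a half-open lattice cell of mesh `s⁻¹`, in multiplied form. [folklore] -/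
private theorem mul_bounds_of_mem_Ico {s t : ℝ} (hs : 0 < s) {a : ℤ}
    (h : t ∈ Ico ((a : ℝ) * s⁻¹) (((a : ℝ) + 1) * s⁻¹)) : (a : ℝ) ≤ t * s ∧ t * s ≤ a + 1 := by
  rw [Set.mem_Ico, ← div_eq_mul_inv, ← div_eq_mul_inv, div_le_iff₀ hs, lt_div_iff₀ hs] at h
  exact ⟨h.1, h.2.le⟩

/-! ## §2 The boxes of `𝐃_{i,α}` and the box-pair weight -/

/-- The spatial part `x⃗ = (x₁, x₂, x₃)` of a space-time point `x ∈ ℝ⁴` (coordinate `0` = time), as a Euclidean vector.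
[cite: MagnenRivasseauSeneor1993, §II.B (II.27) p.335 («|x⃗ − y⃗|»)] -/
def spat3 (x : Fin 4 → ℝ) : EuclideanSpace ℝ (Fin 3) := WithLp.toLp 2 (fun j : Fin 3 => x j.succ)

/-- components of `x⃗`. [cite: MagnenRivasseauSeneor1993, §II.B (II.27) p.335] -/
@[simp] theorem spat3_apply (x : Fin 4 → ℝ) (j : Fin 3) : spat3 x j = x j.succ := rfl

/-- The argument `x − y = (x₀ − y₀, x⃗ − y⃗) ∈ ℝ × ℝ³` of the sliced kernels of `…MRS93LargeFieldSmallFactor` ((II.27)) and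
`…MRS93ConvergencePowerCounting` ((VII.1)), read off a space-time point of `ℝ⁴`. [cite: MagnenRivasseauSeneor1993, §II.B (II.27) p.335] -/
def toTS (x : Fin 4 → ℝ) : ℝ × EuclideanSpace ℝ (Fin 3) := (x 0, spat3 x)

/-- The time-label distance `|k₀ − k′₀|` of two boxes of `𝐃_{i,α}` (labels `k, k′ ∈ ℤ⁴`, lower corners in units of the sides).
[cite: MagnenRivasseauSeneor1993, §II.B p.335 tl.16–19 and p.336 tl.6–8] -/
def dT (k k' : Fin 4 → ℤ) : ℕ := (k 0 - k' 0).natAbs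

/-- The spatial-label sup-distance `max_{j=1,2,3} |k_j − k′_j|` of two boxes of `𝐃_{i,α}`.
[cite: MagnenRivasseauSeneor1993, §II.B p.335 tl.16–19 and p.336 tl.6–8] -/
def dS (k k' : Fin 4 → ℤ) : ℝ := supDist 3 (Fin.tail k) (Fin.tail k')

/-- **The box-pair weight matched to `𝐃_{i,α}`**: `w_q(Δ, Δ′) = (1 + |k₀ − k′₀|)^{−q} (1 + max_j |k_j − k′_j|)^{−q}` — the decay
(II.27)/(VII.1) transported from points to boxes, with «different rates of spatial decay in the zero component and the spatial
component of x − y. This is the reason for which we must use rectangular boxes with a double index» (p.336 tl.6–8).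
[cite: MagnenRivasseauSeneor1993, §II.B p.336 tl.6–8, tl.17–21] -/
def boxWeight (q : ℕ) (k k' : Fin 4 → ℤ) : ℝ := (1 / (1 + (dT k k' : ℝ))) ^ q * (1 / (1 + dS k k')) ^ q

/-- `dS ≥ 0`. [folklore] -/
private theorem dS_nonneg (k k' : Fin 4 → ℤ) : 0 ≤ dS k k' := Nat.cast_nonneg _

/-- `w_q ≥ 0`. [cite: MagnenRivasseauSeneor1993, §II.B p.336 tl.17–21] -/
theorem boxWeight_nonneg (q : ℕ) (k k' : Fin 4 → ℤ) : 0 ≤ boxWeight q k k' := by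
  unfold boxWeight; have := dS_nonneg k k'; positivity

/-- Membership in a box of `𝐃_{i,α}` (sides `M^{−α}` in the direction 0, `M^{−i}` in the directions 1, 2, 3; `α ≥ 0`), in
multiplied form: `k₀ ≤ x₀M^α ≤ k₀ + 1` and `k_j ≤ x_jM^i ≤ k_j + 1`. [cite: MagnenRivasseauSeneor1993, §II.B p.335 tl.16–19] -/
theorem bounds_of_mem_anisoBox {M : ℝ} (hM : 0 < M) {i α : ℕ} {k : Fin 4 → ℤ} {x : Fin 4 → ℝ}
    (hx : x ∈ anisoBox M i α k) :
    ((k 0 : ℝ) ≤ x 0 * M ^ α ∧ x 0 * M ^ α ≤ k 0 + 1) ∧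
      ∀ j : Fin 3, (k j.succ : ℝ) ≤ x j.succ * M ^ i ∧ x j.succ * M ^ i ≤ k j.succ + 1 := by
  rw [anisoBox, mem_univ_pi] at hx
  refine ⟨mul_bounds_of_mem_Ico (pow_pos hM α) ?_, fun j => mul_bounds_of_mem_Ico (pow_pos hM i) ?_⟩
  · have h := hx 0
    simpa only [boxSide, if_true, _root_.zpow_neg, zpow_natCast] using h
  · have h := hx j.succ
    simpa only [boxSide, Fin.succ_ne_zero, if_false, _root_.zpow_neg, zpow_natCast] using h

/-- **Decay matched to the shape of the boxes** («the spatial decrease of the propagator is matched to the shape of the boxes in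
which the cluster expansion is performed», p.336 tl.19–20): for `x ∈ Δ_k`, `y ∈ Δ_{k′}` in `𝐃_{i,α}`, the decay factor of
(II.27)/(VII.1) at `x − y` is at most `4^q · w_q(Δ_k, Δ_{k′})`. [cite: MagnenRivasseauSeneor1993, §II.B p.336 tl.17–21; (II.27) p.335] -/
theorem decay_le_boxWeight {M : ℝ} (hM : 0 < M) (i α q : ℕ) {k k' : Fin 4 → ℤ} {x y : Fin 4 → ℝ}
    (hx : x ∈ anisoBox M i α k) (hy : y ∈ anisoBox M i α k') :
    (1 / (1 + |x 0 - y 0| * M ^ α) * (1 / (1 + ‖spat3 (x - y)‖ * M ^ i))) ^ q ≤ 4 ^ q * boxWeight q k k' := by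
  obtain ⟨⟨hx0, hx0'⟩, hxj⟩ := bounds_of_mem_anisoBox hM hx
  obtain ⟨⟨hy0, hy0'⟩, hyj⟩ := bounds_of_mem_anisoBox hM hy
  -- time direction
  have hT : 1 / (1 + |x 0 - y 0| * M ^ α) ≤ 2 / (1 + (dT k k' : ℝ)) :=
    one_div_le_two_div (pow_pos hM α) hx0 hx0' hy0 hy0' le_rfl
  -- space directions: the label sup-distance is attained at some `j`
  obtain ⟨j, -, hj⟩ := exists_mem_eq_sup (univ : Finset (Fin 3)) univ_nonempty
    (fun j => (Fin.tail k j - Fin.tail k' j).natAbs)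
  have hSj : dS k k' = (((k j.succ - k' j.succ).natAbs : ℕ) : ℝ) := by
    unfold dS supDist; rw [hj]; rfl
  have hnorm : |x j.succ - y j.succ| ≤ ‖spat3 (x - y)‖ := by
    have h := PiLp.norm_apply_le (spat3 (x - y)) j
    rwa [spat3_apply, Pi.sub_apply, Real.norm_eq_abs] at h
  have hS : 1 / (1 + ‖spat3 (x - y)‖ * M ^ i) ≤ 2 / (1 + dS k k') := by
    rw [hSj]
    exact one_div_le_two_div (pow_pos hM i) (hxj j).1 (hxj j).2 (hyj j).1 (hyj j).2 hnorm
  have hS0 := dS_nonneg k k'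
  have hprod : 1 / (1 + |x 0 - y 0| * M ^ α) * (1 / (1 + ‖spat3 (x - y)‖ * M ^ i))
      ≤ 2 / (1 + (dT k k' : ℝ)) * (2 / (1 + dS k k')) :=
    mul_le_mul hT hS (by positivity) (by positivity)
  calc (1 / (1 + |x 0 - y 0| * M ^ α) * (1 / (1 + ‖spat3 (x - y)‖ * M ^ i))) ^ q
      ≤ (2 / (1 + (dT k k' : ℝ)) * (2 / (1 + dS k k'))) ^ q := pow_le_pow_left₀ (by positivity) hprod q
    _ = 4 ^ q * boxWeight q k k' := by
        have h4 : (4 : ℝ) ^ q = 2 ^ q * 2 ^ q := by rw [← mul_pow]; norm_num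
        rw [boxWeight, mul_pow, div_pow, div_pow, h4, one_div, one_div, inv_pow, inv_pow]
        ring

/-- `toTS (x − y) = (x₀ − y₀, x⃗ − y⃗)`. [folklore] -/
private theorem toTS_sub_fst (x y : Fin 4 → ℝ) : (toTS (x - y)).1 = x 0 - y 0 := rfl

/-- `toTS (x − y) = (x₀ − y₀, x⃗ − y⃗)`. [folklore] -/
private theorem toTS_sub_snd (x y : Fin 4 → ℝ) : (toTS (x - y)).2 = spat3 (x - y) := rfl

/-! ## §3 The sliced propagators between boxes: (II.27) and (VII.1) transported to `𝐃_{i,α}` -/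

/-- **(II.27) between boxes.** If the sliced axial propagator family satisfies (II.27) with exponent `q` and constant `K_q`
(`LargeField.AxialSliceBound`), then for `x ∈ Δ_k`, `y ∈ Δ_{k′}` in `𝐃_{i,α}`:
`|C^{i,α}_axial(x − y)| ≤ (K_q M^{2i}/λ) · 4^q · w_q(Δ_k, Δ_{k′})` — «Using the bound (II.27) we can perform a cluster expansion between
the rectangular boxes of the large field region» (p.336 tl.17–18). [cite: MagnenRivasseauSeneor1993, §II.B (II.27) p.335, p.336 tl.17–21] -/
theorem abs_le_boxWeight_of_axialSliceBound {C : ℕ → ℕ → ℝ × EuclideanSpace ℝ (Fin 3) → ℝ} {M lam Kq : ℝ} {q : ℕ}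
    (hM : 0 < M) (hlam : 0 < lam) (hKq : 0 ≤ Kq) (h27 : LargeField.AxialSliceBound C M lam q Kq) (i α : ℕ)
    {k k' : Fin 4 → ℤ} {x y : Fin 4 → ℝ} (hx : x ∈ anisoBox M i α k) (hy : y ∈ anisoBox M i α k') :
    |C i α (toTS (x - y))| ≤ Kq * M ^ (2 * i) / lam * 4 ^ q * boxWeight q k k' := by
  refine (h27 i α (toTS (x - y))).trans ?_
  rw [toTS_sub_fst, toTS_sub_snd, mul_assoc (Kq * M ^ (2 * i) / lam)]
  exact mul_le_mul_of_nonneg_left (decay_le_boxWeight hM i α q hx hy) (by positivity)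

/-- **(VII.1) between boxes.** The same transport for the small-field sliced propagator of Sect. VII
(`Convergence.SliceBound`, rate `K_q M^i M^α`): `|C^{i,α}(x − y)| ≤ K_q M^i M^α · 4^q · w_q(Δ_k, Δ_{k′})` for `x ∈ Δ_k`, `y ∈ Δ_{k′}`.
[cite: MagnenRivasseauSeneor1993, Sect. VII (VII.1) p.375; §II.B p.336 tl.17–21] -/
theorem abs_le_boxWeight_of_sliceBound {C : ℕ → ℕ → ℝ × EuclideanSpace ℝ (Fin 3) → ℝ} {M Kq : ℝ} {q : ℕ}
    (hM : 0 < M) (hKq : 0 ≤ Kq) (h71 : Convergence.SliceBound C M q Kq) (i α : ℕ)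
    {k k' : Fin 4 → ℤ} {x y : Fin 4 → ℝ} (hx : x ∈ anisoBox M i α k) (hy : y ∈ anisoBox M i α k') :
    |C i α (toTS (x - y))| ≤ Kq * M ^ i * M ^ α * 4 ^ q * boxWeight q k k' := by
  refine (h71 i α (toTS (x - y))).trans ?_
  rw [toTS_sub_fst, toTS_sub_snd, mul_assoc (Kq * M ^ i * M ^ α)]
  exact mul_le_mul_of_nonneg_left (decay_le_boxWeight hM i α q hx hy) (by positivity)

/-! ## §4 Summability over the box lattice: «q equal to 4, so that the propagator is summable» (p.336 tl.14–16) -/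

/-- `(1/(1 + d))^q = (1 + d)^{−q}` (natural versus real exponent). [folklore] -/
private theorem one_div_pow_eq_rpow_neg {d : ℝ} (hd : 0 ≤ d) (q : ℕ) : (1 / (1 + d)) ^ q = (1 + d) ^ (-(q : ℝ)) := by
  rw [Real.rpow_neg (by positivity), Real.rpow_natCast, one_div, inv_pow]

/-- **Time direction**: `Σ_{a′ ∈ S} (1 + |a − a′|)^{−r} ≤ 2ζ(r)` for `r > 1`, uniformly in the finite set `S ⊂ ℤ` and in `a`
(`ζ(r) = Σ'_{m ≥ 0} (1 + m)^{−r}` = `PolymerTreeSum.ZLattice.T1 r`; the case `d = 1` of `PolymerTreeSum.ZLattice.row_sum_le`).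
[cite: Rivasseau1991, §III.1 (III.1.6), PDF p.149] -/
theorem sum_time_le {r : ℝ} (hr : 1 < r) (a : ℤ) (S : Finset ℤ) :
    ∑ a' ∈ S, (1 + ((a - a').natAbs : ℝ)) ^ (-r) ≤ 2 * T1 r := by
  set e : ℤ → (Fin 1 → ℤ) := fun n _ => n with he
  have hinj : Set.InjOn e (S : Set ℤ) := fun n _ n' _ h => by simpa [he] using congr_fun h 0
  have hsup : ∀ n n' : ℤ, supDist 1 (e n) (e n') = ((n - n').natAbs : ℝ) := fun n n' => by
    unfold supDist
    simp only [he]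
    rw [Finset.sup_const univ_nonempty]
  have h := row_sum_le 1 one_pos (by simpa using hr) (e a) (S.image e)
  rw [sum_image hinj, Nat.cast_one, div_one, pow_one] at h
  simpa only [hsup] using h

/-- **Space directions**: `Σ_{b′ ∈ S} (1 + max_j |b_j − b′_j|)^{−r} ≤ (2ζ(r/3))³` for `r > 3`, uniformly in the finite set
`S ⊂ ℤ³` and in `b` (`PolymerTreeSum.ZLattice.row_sum_le` with `d = 3`). [cite: Rivasseau1991, §III.1 (III.1.6), PDF p.149] -/
theorem sum_space_le {r : ℝ} (hr : 3 < r) (b : Fin 3 → ℤ) (S : Finset (Fin 3 → ℤ)) :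
    ∑ b' ∈ S, (1 + supDist 3 b b') ^ (-r) ≤ (2 * T1 (r / 3)) ^ 3 := by
  have h := row_sum_le 3 (by norm_num) (by simpa using hr) b S
  simpa using h

/-- **Row sums of the box-pair weight, uniformly in the finite set of boxes** — the summability behind «In theory it might be
sufficient to take q in (II.27) equal to 4, so that the propagator is summable» (p.336 tl.14–16): for every `q ≥ 4`, every finite
`Λ ⊂ 𝐃_{i,α}` (labels in `ℤ⁴`) and every box `Δ_k`, `Σ_{Δ′ ∈ Λ} w_q(Δ_k, Δ′) ≤ 2ζ(q) · (2ζ(q/3))³` — a constant depending on `q` only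
(not on `i`, `α`, `M`, `λ`, `Λ`). With the isotropic sup-distance on `ℤ⁴` one would need `q > 4`; the product structure of `w_q`
(time × space) is what makes `q = 4` suffice. [cite: MagnenRivasseauSeneor1993, §II.B p.336 tl.14–16, tl.17–21] -/
theorem sum_boxWeight_le {q : ℕ} (hq : 4 ≤ q) (k : Fin 4 → ℤ) (Λ : Finset (Fin 4 → ℤ)) :
    ∑ k' ∈ Λ, boxWeight q k k' ≤ 2 * T1 q * (2 * T1 (q / 3)) ^ 3 := by
  have hq1 : (1 : ℝ) < q := by exact_mod_cast (show 1 < q by omega)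
  have hq3 : (3 : ℝ) < q := by exact_mod_cast (show 3 < q by omega)
  -- split a label into its time and space parts
  set e : (Fin 4 → ℤ) → ℤ × (Fin 3 → ℤ) := fun k' => (k' 0, Fin.tail k') with he
  have hinj : Set.InjOn e (Λ : Set (Fin 4 → ℤ)) := by
    intro k₁ _ k₂ _ h
    simp only [he, Prod.mk.injEq] at h
    rw [← Fin.cons_self_tail k₁, ← Fin.cons_self_tail k₂, h.1, h.2]
  set fT : ℤ → ℝ := fun a' => (1 + ((k 0 - a').natAbs : ℝ)) ^ (-(q : ℝ)) with hfT
  set fS : (Fin 3 → ℤ) → ℝ := fun b' => (1 + supDist 3 (Fin.tail k) b') ^ (-(q : ℝ)) with hfS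
  have hfT0 : ∀ a', 0 ≤ fT a' := fun a' => Real.rpow_nonneg (by positivity) _
  have hfS0 : ∀ b', 0 ≤ fS b' := fun b' => Real.rpow_nonneg (by unfold supDist; positivity) _
  have hw : ∀ k' ∈ Λ, boxWeight q k k' = fT (e k').1 * fS (e k').2 := fun k' _ => by
    simp only [boxWeight, hfT, hfS, he]
    rw [one_div_pow_eq_rpow_neg (Nat.cast_nonneg _), one_div_pow_eq_rpow_neg (dS_nonneg k k')]
    rfl
  have hre : ∑ k' ∈ Λ, fT (e k').1 * fS (e k').2 = ∑ p ∈ Λ.image e, fT p.1 * fS p.2 :=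
    (sum_image (f := fun p : ℤ × (Fin 3 → ℤ) => fT p.1 * fS p.2) hinj).symm
  rw [sum_congr rfl hw, hre]
  have hsub : Λ.image e ⊆ Λ.image (fun k' => k' 0) ×ˢ Λ.image Fin.tail := by
    intro p hp
    obtain ⟨k', hk', rfl⟩ := mem_image.1 hp
    exact mem_product.2 ⟨mem_image_of_mem _ hk', mem_image_of_mem _ hk'⟩
  refine (sum_le_sum_of_subset_of_nonneg hsub fun p _ _ => mul_nonneg (hfT0 _) (hfS0 _)).trans ?_
  rw [sum_product, ← sum_mul_sum]
  have hT := sum_time_le hq1 (k 0) (Λ.image fun k' => k' 0)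
  have hS := sum_space_le hq3 (Fin.tail k) (Λ.image Fin.tail)
  have hS0 : 0 ≤ ∑ b' ∈ Λ.image Fin.tail, fS b' := sum_nonneg fun b' _ => hfS0 b'
  have hT1 : 0 ≤ 2 * T1 q := (sum_nonneg fun a' _ => hfT0 a').trans hT
  exact mul_le_mul hT hS hS0 hT1

/-! ## §5 The inputs of the local factorial principle [R] for fields located in the boxes of `𝐃_{i,α}` -/

/-- The covariance weight between two boxes of `𝐃_{i,α}` produced by (II.27): `w^{i,α}(Δ, Δ′) = (K_q M^{2i}/λ)·4^q·w_q(Δ, Δ′)`.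
[cite: MagnenRivasseauSeneor1993, §II.B (II.27) p.335, p.336 tl.17–21] -/
def axialBoxWeight (Kq M lam : ℝ) (q i : ℕ) (k k' : Fin 4 → ℤ) : ℝ := Kq * M ^ (2 * i) / lam * 4 ^ q * boxWeight q k k'

/-- `w^{i,α} ≥ 0` (the hypothesis `hw` of `GaussianLocalFactorial.abs_moment_density_le_localFactorial`).
[cite: MagnenRivasseauSeneor1993, §II.B (II.27) p.335] -/
theorem axialBoxWeight_nonneg {Kq M lam : ℝ} (hM : 0 < M) (hlam : 0 < lam) (hKq : 0 ≤ Kq) (q i : ℕ)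
    (k k' : Fin 4 → ℤ) : 0 ≤ axialBoxWeight Kq M lam q i k k' := by
  unfold axialBoxWeight; have := boxWeight_nonneg q k k'; positivity

/-- **Row sums of `w^{i,α}`** (the hypothesis `hB` of the local factorial principle, «a constant per sum»): for `q ≥ 4` and every
finite set `Λ` of boxes of `𝐃_{i,α}`, `Σ_{Δ′∈Λ} w^{i,α}(Δ, Δ′) ≤ (K_q M^{2i}/λ) · 4^q · 2ζ(q)(2ζ(q/3))³`.
[cite: MagnenRivasseauSeneor1993, §II.B p.336 tl.14–21] -/
theorem sum_axialBoxWeight_le {Kq M lam : ℝ} (hM : 0 < M) (hlam : 0 < lam) (hKq : 0 ≤ Kq) {q : ℕ} (hq : 4 ≤ q)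
    (i : ℕ) (Λ : Finset (Fin 4 → ℤ)) :
    ∀ k ∈ Λ, ∑ k' ∈ Λ, axialBoxWeight Kq M lam q i k k'
      ≤ Kq * M ^ (2 * i) / lam * 4 ^ q * (2 * T1 q * (2 * T1 (q / 3)) ^ 3) := by
  intro k _
  unfold axialBoxWeight
  rw [← mul_sum]
  exact mul_le_mul_of_nonneg_left (sum_boxWeight_le hq k Λ) (by positivity)

/-- **Covariances dominated through the boxes** (the hypothesis `hdom` of the local factorial principle): if the fields `n ∈ W`
sit at points `x_n ∈ Δ_{ℓ n}` of `𝐃_{i,α}` and their covariance is (bounded by) the sliced axial propagator `C^{i,α}_axial(x_n − x_m)`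
obeying (II.27), then `|cov(n, m)| ≤ w^{i,α}(Δ_{ℓ n}, Δ_{ℓ m})` — «Each factor E_Δ contains P_i fields which are integrated with
respect to C_axial» (p.336 tl.18–19). [cite: MagnenRivasseauSeneor1993, §II.B (II.26)–(II.27) p.335, p.336 tl.17–21] -/
theorem cov_le_axialBoxWeight {W : Type*} {C : ℕ → ℕ → ℝ × EuclideanSpace ℝ (Fin 3) → ℝ} {M lam Kq : ℝ} {q : ℕ}
    (hM : 0 < M) (hlam : 0 < lam) (hKq : 0 ≤ Kq) (h27 : LargeField.AxialSliceBound C M lam q Kq) (i α : ℕ)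
    (pos : W → Fin 4 → ℝ) (ℓ : W → Fin 4 → ℤ) (hpos : ∀ n, pos n ∈ anisoBox M i α (ℓ n))
    (cov : W → W → ℝ) (hcov : ∀ n m, |cov n m| ≤ |C i α (toTS (pos n - pos m))|) (n m : W) :
    |cov n m| ≤ axialBoxWeight Kq M lam q i (ℓ n) (ℓ m) :=
  (hcov n m).trans (abs_le_boxWeight_of_axialSliceBound hM hlam hKq h27 i α (hpos n) (hpos m))

/-! ## §6 From local factorials to the left side of (II.28): the per-box factor `(λ_i^t)^{ε₁P_i} K^{P_i} (P_i/2)!` -/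

/-- `√((2m)!) ≤ 2^m · m!` (from `(2m)! = C(2m, m)·(m!)²` and `C(2m, m) ≤ 4^m`): the local factorial `√(P!)` of a box holding
`P = 2m` fields against the printed `(P/2)!` of (II.28). [cite: MagnenRivasseauSeneor1993, §II.B (II.28) p.336 tl.21–23 («(P_i/2)!»)] -/
theorem sqrt_factorial_two_mul_le (m : ℕ) : Real.sqrt ((2 * m)! : ℝ) ≤ 2 ^ m * (m ! : ℝ) := by
  have h : ((2 * m)! : ℝ) ≤ (2 ^ m * (m ! : ℝ)) ^ 2 := by
    have h1 : (2 * m).choose m * m ! * (2 * m - m)! = (2 * m)! := Nat.choose_mul_factorial_mul_factorial (by omega)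
    rw [show 2 * m - m = m by omega] at h1
    have h2 : (2 * m).choose m ≤ 4 ^ m := by
      rw [← Nat.centralBinom_eq_two_mul_choose]; exact Nat.centralBinom_le_four_pow m
    have h3 : (2 * m)! ≤ 4 ^ m * m ! * m ! := by
      rw [← h1]; exact Nat.mul_le_mul_right _ (Nat.mul_le_mul_right _ h2)
    calc ((2 * m)! : ℝ) ≤ ((4 ^ m * m ! * m ! : ℕ) : ℝ) := by exact_mod_cast h3
      _ = (2 ^ m * (m ! : ℝ)) ^ 2 := by
          push_cast
          rw [show (4 : ℝ) = 2 ^ 2 by norm_num, ← pow_mul, mul_pow, ← pow_mul]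
          ring_nf
  calc Real.sqrt ((2 * m)! : ℝ) ≤ Real.sqrt ((2 ^ m * (m ! : ℝ)) ^ 2) := Real.sqrt_le_sqrt h
    _ = 2 ^ m * (m ! : ℝ) := Real.sqrt_sq (by positivity)

/-- The number of fields is the sum of the occupation numbers of the boxes: `#W = Σ_{Δ∈Λ} N(Δ)` when every field sits in a box
of `Λ`. [folklore] -/
private theorem card_eq_sum_occ {W : Type} [Fintype W] {Cu : Type*} [DecidableEq Cu] (ℓ : W → Cu) (Λ : Finset Cu)
    (hΛ : ∀ n, ℓ n ∈ Λ) : Fintype.card W = ∑ Δ ∈ Λ, occ ℓ Δ := by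
  rw [← card_univ]
  exact card_eq_sum_card_fiberwise fun n _ => hΛ n

/-- Regrouping a global power and the local factorials box by box: `x^{#W} · ∏_{Δ∈Λ} √(N(Δ)!) = ∏_{Δ∈Λ} x^{N(Δ)} √(N(Δ)!)`.
[folklore] -/
private theorem pow_card_mul_locFact {W : Type} [Fintype W] {Cu : Type*} [DecidableEq Cu] (ℓ : W → Cu) (Λ : Finset Cu)
    (hΛ : ∀ n, ℓ n ∈ Λ) (x : ℝ) :
    x ^ Fintype.card W * locFact ℓ Λ = ∏ Δ ∈ Λ, (x ^ occ ℓ Δ * Real.sqrt ((occ ℓ Δ)! : ℝ)) := by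
  rw [card_eq_sum_occ ℓ Λ hΛ, ← prod_pow_eq_pow_sum, locFact, prod_mul_distrib]

/-- **The power counting of (II.26)–(II.28).** The field normalisation `(λ_i^t)^{1/2+ε₁} M^{−i}` of (II.26) times the square root
`√(2B)` of the covariance row-sum constant `B = (K_q M^{2i}/λ)·R` of (II.27) is `λ^{ε₁} · √(2K_qR)` — the factors `M^{±i}` and `λ^{∓1/2}`
cancel («the Gaussian measure corresponding to C_axial gives for a field A^j a typical size M^iλ^{−1/2}», p.336 tl.9–10), leaving
`λ^{ε₁}` per field. [cite: MagnenRivasseauSeneor1993, §II.B (II.26)–(II.28) pp.335–336, p.336 tl.9–10] -/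
theorem normalisation_mul_sqrt {M lam Kq R : ℝ} (hM : 0 < M) (hlam : 0 < lam) (hKq : 0 ≤ Kq) (hR : 0 ≤ R) (ε₁ : ℝ) (i : ℕ) :
    lam ^ (1 / 2 + ε₁) * M ^ (-(i : ℤ)) * Real.sqrt (2 * (Kq * M ^ (2 * i) / lam * R))
      = lam ^ ε₁ * Real.sqrt (2 * Kq * R) := by
  have hMi : 0 < M ^ i := pow_pos hM i
  have h1 : 2 * (Kq * M ^ (2 * i) / lam * R) = (2 * Kq * R) * ((M ^ i) ^ 2 * lam⁻¹) := by
    rw [pow_mul', div_eq_mul_inv]; ring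
  have hl2 : 0 < lam ^ (1 / 2 : ℝ) := Real.rpow_pos_of_pos hlam _
  rw [h1, Real.sqrt_mul (by positivity : (0 : ℝ) ≤ 2 * Kq * R) ((M ^ i) ^ 2 * lam⁻¹),
    Real.sqrt_mul' ((M ^ i) ^ 2) (inv_nonneg.2 hlam.le), Real.sqrt_sq hMi.le, Real.sqrt_inv,
    Real.sqrt_eq_rpow lam, _root_.zpow_neg, zpow_natCast, Real.rpow_add hlam]
  field_simp

/-- **The per-box factor of (II.28), left side.** A box holding `P = 2m` fields, each weighing `λ^{ε₁}K₀`, with local factorial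
`√(P!)`, carries at most `λ^{ε₁P} · (√2K₀)^{P} · (P/2)!` — the printed shape «(λ_i^t)^{ε₁P_i} K^{P_i} (P_i/2)!» with `K = √2K₀`.
[cite: MagnenRivasseauSeneor1993, §II.B (II.28) p.336 tl.21–23] -/
theorem box_factor_le {lam K₀ ε₁ : ℝ} (hlam : 0 ≤ lam) (m : ℕ) :
    (lam ^ ε₁ * K₀) ^ (2 * m) * Real.sqrt ((2 * m)! : ℝ)
      ≤ lam ^ (ε₁ * (2 * m : ℕ)) * (Real.sqrt 2 * K₀) ^ (2 * m) * (m ! : ℝ) := by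
  have h0 : 0 ≤ (lam ^ ε₁ * K₀) ^ (2 * m) := (even_two_mul m).pow_nonneg _
  have h1 := mul_le_mul_of_nonneg_left (sqrt_factorial_two_mul_le m) h0
  refine h1.trans (le_of_eq ?_)
  rw [Real.rpow_mul_natCast hlam, mul_pow, mul_pow, pow_mul (Real.sqrt 2) 2 m, Real.sq_sqrt zero_le_two]
  ring

/-- **«We obtain a product of local factorials in the number of the fields in each box [R]. Therefore for each box Δ we have a
factor (λ_i^t)^{ε₁P_i} K^{P_i} (P_i/2)!»** (p.336 tl.20–23) — the bookkeeping, kernel-checked: if a quantity `X` (the Gaussian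
integral of `∏_n φ(x_n)` against a density `|F| ≤ 1`, normalised) obeys the LOCAL FACTORIAL BOUND
`X ≤ √(2B)^{#W} ∏_{Δ∈Λ} √(N(Δ)!)` with the (II.27) row-sum constant `B = (K_q M^{2i}/λ)·R` (this is the conclusion of
`GaussianLocalFactorial.abs_moment_density_le_localFactorial` fed with §5), then after the field normalisation
`c = (λ_i^t)^{1/2+ε₁}M^{−i}` of (II.26): `c^{#W} · X ≤ ∏_{Δ∈Λ} (λ^{ε₁}K₀)^{N(Δ)} √(N(Δ)!)`, `K₀ = √(2K_qR)` — one factor per box,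
depending on the box only through its number of fields. [cite: MagnenRivasseauSeneor1993, §II.B (II.26)–(II.28) pp.335–336] -/
theorem normalised_le_prod_boxes {W : Type} [Fintype W] (ℓ : W → (Fin 4 → ℤ)) (Λ : Finset (Fin 4 → ℤ)) (hΛ : ∀ n, ℓ n ∈ Λ)
    {M lam Kq R ε₁ X : ℝ} (hM : 0 < M) (hlam : 0 < lam) (hKq : 0 ≤ Kq) (hR : 0 ≤ R) (i : ℕ)
    (hX : X ≤ Real.sqrt (2 * (Kq * M ^ (2 * i) / lam * R)) ^ Fintype.card W * locFact ℓ Λ) :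
    (lam ^ (1 / 2 + ε₁) * M ^ (-(i : ℤ))) ^ Fintype.card W * X
      ≤ ∏ Δ ∈ Λ, ((lam ^ ε₁ * Real.sqrt (2 * Kq * R)) ^ occ ℓ Δ * Real.sqrt ((occ ℓ Δ)! : ℝ)) := by
  have hc : 0 ≤ lam ^ (1 / 2 + ε₁) * M ^ (-(i : ℤ)) := by positivity
  refine (mul_le_mul_of_nonneg_left hX (pow_nonneg hc _)).trans (le_of_eq ?_)
  rw [← mul_assoc, ← mul_pow, normalisation_mul_sqrt hM hlam hKq hR ε₁ i, pow_card_mul_locFact ℓ Λ hΛ]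

/-- **(II.28), both sides, for a configuration with `P_i = 2m` fields in each box of `Λ`.** Under the local factorial bound of
`normalised_le_prod_boxes` and `N(Δ) = 2m` for every `Δ ∈ Λ`: `c^{#W} · X ≤ (λ^{ε₁P} K^{P} (P/2)!)^{#Λ}` with `K = √2·√(2K_qR) = 2√(K_qR)`,
and if moreover `2m = λ^{−ε₁/2}` and `K λ^{3ε₁/4} ≤ e^{−1}` («if λ_i^t is small enough»; the kernel-checked smallness condition of
`LargeField.localFactorial_le`), then `c^{#W} · X ≤ (e^{−λ^{−ε₁/2}})^{#Λ}` — one small factor `e^{−(λ_i^t)^{−ε₁/2}}` per box.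
[cite: MagnenRivasseauSeneor1993, §II.B (II.28) p.336 tl.21–25] -/
theorem normalised_le_exp_pow_card {W : Type} [Fintype W] (ℓ : W → (Fin 4 → ℤ)) (Λ : Finset (Fin 4 → ℤ))
    (hΛ : ∀ n, ℓ n ∈ Λ) {M lam Kq R ε₁ X : ℝ} (hM : 0 < M) (hlam : 0 < lam) (hKq : 0 ≤ Kq) (hR : 0 ≤ R) (i : ℕ)
    (hX : X ≤ Real.sqrt (2 * (Kq * M ^ (2 * i) / lam * R)) ^ Fintype.card W * locFact ℓ Λ)
    {m : ℕ} (hocc : ∀ Δ ∈ Λ, occ ℓ Δ = 2 * m) (hP : (2 * m : ℝ) = lam ^ (-(ε₁ / 2)))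
    (hsmall : Real.sqrt 2 * Real.sqrt (2 * Kq * R) * lam ^ (3 * ε₁ / 4) ≤ Real.exp (-1)) :
    (lam ^ (1 / 2 + ε₁) * M ^ (-(i : ℤ))) ^ Fintype.card W * X ≤ Real.exp (-(lam ^ (-(ε₁ / 2)))) ^ Λ.card := by
  refine (normalised_le_prod_boxes ℓ Λ hΛ hM hlam hKq hR i hX).trans ?_
  rw [← prod_const]
  refine prod_le_prod (fun Δ _ => by positivity) fun Δ hΔ => ?_
  rw [hocc Δ hΔ]
  refine (box_factor_le hlam.le m).trans ?_
  have h := LargeField.localFactorial_le (ε₁ := ε₁) hlam (by positivity : 0 ≤ Real.sqrt 2 * Real.sqrt (2 * Kq * R)) hP hsmall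
  simpa using h

/-! ## §7 (Edition v1.1, add-only) Fields smeared over their boxes: the averages `(1/|Δ|)∫_Δ` of (II.26) cost nothing -/

/-- **A box average of a bounded quantity is bounded by the same constant**: if `|G(x)| ≤ B` for every position `x ∈ Δ` (a set of
finite volume), then `|(1/|Δ|)∫_Δ G| ≤ B` — the shape `(1/|Δ|)∫_Δ …` of (II.26) ∕ (II.29b) (`PhaseCells.powerAverage`). (If `|Δ| = 0` or
`G` is not integrable the left side is `0` by the integral conventions.) [cite: MagnenRivasseauSeneor1993, §II.B (II.26) p.335 tl.23–24] -/
theorem abs_boxAverage_le {X : Type*} [MeasurableSpace X] (μ : Measure X) {Δ : Set X} (hΔ : μ Δ < ⊤) {G : X → ℝ} {B : ℝ}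
    (hB : 0 ≤ B) (hG : ∀ x ∈ Δ, |G x| ≤ B) : |(μ Δ).toReal⁻¹ * ∫ x in Δ, G x ∂μ| ≤ B := by
  have h1 : ‖∫ x in Δ, G x ∂μ‖ ≤ B * μ.real Δ :=
    norm_setIntegral_le_of_norm_le_const hΔ fun x hx => by rw [Real.norm_eq_abs]; exact hG x hx
  rw [Real.norm_eq_abs, measureReal_def] at h1
  rw [abs_mul, abs_inv, abs_of_nonneg ENNReal.toReal_nonneg]
  rcases eq_or_lt_of_le (ENNReal.toReal_nonneg : 0 ≤ (μ Δ).toReal) with h0 | hpos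
  · rw [← h0, _root_.inv_zero, zero_mul]; exact hB
  · rw [inv_mul_le_iff₀ hpos]; linarith [mul_comm B (μ Δ).toReal]

/-- **Several boxes at once** («Each factor E_Δ contains P_i fields», one average `(1/|Δ|)∫_Δ dx_Δ` per box): if a quantity
`G(x)` depending on one position `x_b ∈ Δ_b` per box `b` obeys `|G(x)| ≤ B` for all admissible position choices, then its average
over all positions, `(∏_b |Δ_b|)⁻¹ ∫_{∏_b Δ_b} G`, obeys the same bound — so a bound proved position by position (as in §6) passes to
the smeared fields of (II.26). [cite: MagnenRivasseauSeneor1993, §II.B (II.26) p.335 tl.23–24, p.336 tl.18–19] -/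
theorem abs_multiBoxAverage_le {Bx : Type} [Fintype Bx] (Δ : Bx → Set (Fin 4 → ℝ)) (hΔ : ∀ b, volume (Δ b) < ⊤)
    {G : (Bx → (Fin 4 → ℝ)) → ℝ} {B : ℝ} (hB : 0 ≤ B) (hG : ∀ xs ∈ Set.pi univ Δ, |G xs| ≤ B) :
    |(volume (Set.pi univ Δ)).toReal⁻¹ * ∫ xs in Set.pi univ Δ, G xs| ≤ B := by
  refine abs_boxAverage_le volume ?_ hB hG
  rw [volume_pi_pi]
  exact ENNReal.prod_lt_top fun b _ => hΔ b

/-- The boxes of `𝐃_{i,α}` have finite (indeed positive) volume `M^{−α}(M^{−i})³` (`PhaseCells.volume_anisoBox`), so the two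
lemmas above apply to them. [cite: MagnenRivasseauSeneor1993, §II.B p.335 tl.16–19] -/
theorem volume_anisoBox_lt_top {M : ℝ} (hM : 0 < M) (i : ℕ) (α : ℤ) (k : Fin 4 → ℤ) : volume (anisoBox M i α k) < ⊤ := by
  have h := PhaseCells.volume_anisoBox hM i α k
  have hpos : 0 < (volume (anisoBox M i α k)).toReal := by
    rw [h]; have := zpow_pos hM (-α); have := zpow_pos hM (-(i : ℤ)); positivity
  exact lt_top_iff_ne_top.2 fun htop => by rw [htop, ENNReal.toReal_top] at hpos; exact lt_irrefl _ hpos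


/-! ## §8 (Edition v1.1, add-only) [R]'s tree-decay bound (III.1.28) on ONE anisotropic lattice `𝐃_{i,α}` — «given some fixed box we
can perform the sum over all the boxes linked to it … The structure of these sums is basically similar to the case considered in [R]»
(Sect. VII p.375 tl.2–5) -/

section TreeSum

open Literature.Probability.LatticeModels.PolymerTreeSum (polymerTreeSum polymerTreeSum_le)

/-- The box-pair weight is symmetric. [cite: MagnenRivasseauSeneor1993, §II.B p.336 tl.17–21] -/
theorem boxWeight_symm (q : ℕ) (k k' : Fin 4 → ℤ) : boxWeight q k k' = boxWeight q k' k := by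
  have hT : dT k k' = dT k' k := by
    unfold dT; rw [← Int.natAbs_neg, neg_sub]
  have hS : dS k k' = dS k' k := by
    unfold dS supDist
    congr 2
    funext j
    rw [← Int.natAbs_neg, neg_sub]
  rw [boxWeight, boxWeight, hT, hS]

/-- **Lemma III.1.4 of [R] on the boxes of one lattice `𝐃_{i,α}`, with MRS's product decay and `q ≥ 4`**: for every finite set
`Λ ⊂ 𝐃_{i,α}` of boxes (labels in `ℤ⁴`), every box `o ∈ Λ` and every `p`, the tree-decay sum over the polymers `Y ∋ o`, `Y ⊆ Λ`,
`#Y = p` — `Σ_Y Σ_{trees T on Y} ∏_u d_u! ∏_{u ≠ o} w_q(u, T u)` (`PolymerTreeSum.polymerTreeSum`) — is at most `K̂^p` with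
`K̂ = 8 · max 1 (2ζ(q)(2ζ(q/3))³)`, INDEPENDENT of `Λ`: «given some fixed box we can perform the sum over all the boxes linked to it by
previous horizontal, vertical or Mayer expansions using the decay of the corresponding links. The structure of these sums is basically
similar to the case considered in [R] with one most notable exception, the existence of various lattices with anisotropic shapes» —
for the links inside ONE anisotropic lattice nothing changes: the label space is still `ℤ⁴` and §4's row sums feed
`PolymerTreeSum.polymerTreeSum_le` («any summable decay»). (Links between DIFFERENT lattices are the counts of `…MRS93NestedLattices`
times file 4's exponents; not combined here.) [cite: MagnenRivasseauSeneor1993, Sect. VII p.375 tl.2–5; §II.B p.336 tl.14–21]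
[cite: Rivasseau1991, §III.1 Lemma III.1.4 (III.1.28), PDF p.159] -/
theorem polymerTreeSum_boxWeight_le {q : ℕ} (hq : 4 ≤ q) (Λ : Finset (Fin 4 → ℤ)) (o : Λ) (p : ℕ) :
    polymerTreeSum o (fun a b : Λ => boxWeight q a b) p ≤ (8 * max 1 (2 * T1 q * (2 * T1 (q / 3)) ^ 3)) ^ p := by
  refine polymerTreeSum_le (o := o) (fun a b => boxWeight_nonneg q a b) (B := 2 * T1 q * (2 * T1 (q / 3)) ^ 3) (fun x => ?_) p
  have h := sum_boxWeight_le hq (x : Fin 4 → ℤ) Λ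
  calc ∑ y : Λ, boxWeight q (y : Fin 4 → ℤ) x = ∑ y : Λ, boxWeight q (x : Fin 4 → ℤ) y :=
        Finset.sum_congr rfl fun y _ => boxWeight_symm q _ _
    _ = ∑ y ∈ Λ, boxWeight q (x : Fin 4 → ℤ) y := Finset.sum_coe_sort Λ (fun y => boxWeight q (x : Fin 4 → ℤ) y)
    _ ≤ 2 * T1 q * (2 * T1 (q / 3)) ^ 3 := h

end TreeSum

/-! ## §9 (Edition v1.2, add-only) The local factorial principle [R] APPLIED: Gaussian fields located in the boxes of `𝐃_{i,α}`,
covariances dominated by the sliced axial propagator (II.27) -/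

section Gaussian

open Literature.MathematicalPhysics.QuantumFieldTheory.Balaban1983to89.B2Eq228Conditioning (weight)
open Literature.MathematicalPhysics.QuantumFieldTheory.GaussianLocalFactorial (abs_moment_density_le_localFactorial)

variable {S : Type} [Fintype S] [DecidableEq S] {W : Type} [Fintype W] [DecidableEq W] [LinearOrder W]

/-- **«We obtain a product of local factorials in the number of the fields in each box [R]»** (p.336 tl.20–21), for the
finite-dimensional Gaussian measures of `…GaussianLocalFactorials`: a centred Gaussian measure `dμ ∝ e^{−½⟨φ,Aφ⟩}dφ` on `ℝ^S`,
fields `φ(v_n)` (`n ∈ W`) sitting at points `x_n` of boxes `Δ_{ℓ n} ∈ Λ ⊂ 𝐃_{i,α}` whose covariances are dominated by a sliced axial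
kernel obeying (II.27) with exponent `q ≥ 4`, `|⟨A⁻¹v_n, v_m⟩| ≤ |C^{i,α}_axial(x_n − x_m)|`, and ANY measurable density `|F| ≤ 1`:
`|∫ ∏_n φ(v_n)·F dμ ∕ Z| ≤ √(2B)^{#W} · ∏_{Δ∈Λ} √(N(Δ)!)` with `B = (K_q M^{2i}/λ)·4^q·2ζ(q)(2ζ(q/3))³` and `N(Δ)` the number of fields
in the box `Δ`. (§5 fed into `GaussianLocalFactorial.abs_moment_density_le_localFactorial`.)
[cite: MagnenRivasseauSeneor1993, §II.B p.336 tl.17–21; (II.27) p.335] [cite: Rivasseau1991, §II.6 Lemma II.6.2; §III.1 Lemma III.1.2, PDF p.158 L1] -/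
theorem abs_moment_density_le_localFactorial_boxes {C : ℕ → ℕ → ℝ × EuclideanSpace ℝ (Fin 3) → ℝ} {M lam Kq : ℝ}
    (hM : 0 < M) (hlam : 0 < lam) (hKq : 0 ≤ Kq) {q : ℕ} (hq : 4 ≤ q) (h27 : LargeField.AxialSliceBound C M lam q Kq) (i α : ℕ)
    (A : Matrix S S ℝ) (hA : A.PosDef) (v : W → S → ℝ) (pos : W → Fin 4 → ℝ) (ℓ : W → (Fin 4 → ℤ))
    (hpos : ∀ n, pos n ∈ anisoBox M i α (ℓ n)) (Λ : Finset (Fin 4 → ℤ)) (hΛ : ∀ n, ℓ n ∈ Λ)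
    (hcov : ∀ n m, |(A⁻¹ *ᵥ v n) ⬝ᵥ v m| ≤ |C i α (toTS (pos n - pos m))|)
    {F : (S → ℝ) → ℝ} (hFm : AEStronglyMeasurable F volume) (hF1 : ∀ u, |F u| ≤ 1) :
    |(∫ u : S → ℝ, (∏ n, u ⬝ᵥ v n) * F u * weight A u) / ∫ u : S → ℝ, weight A u|
      ≤ Real.sqrt (2 * (Kq * M ^ (2 * i) / lam * (4 ^ q * (2 * T1 q * (2 * T1 (q / 3)) ^ 3))))
          ^ Fintype.card W * locFact ℓ Λ := by
  have hB : ∀ k ∈ Λ, ∑ k' ∈ Λ, axialBoxWeight Kq M lam q i k k'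
      ≤ Kq * M ^ (2 * i) / lam * (4 ^ q * (2 * T1 q * (2 * T1 (q / 3)) ^ 3)) :=
    fun k hk => (sum_axialBoxWeight_le hM hlam hKq hq i Λ k hk).trans_eq (by ring)
  exact abs_moment_density_le_localFactorial A hA v ℓ Λ hΛ (fun k k' => axialBoxWeight_nonneg hM hlam hKq q i k k') hB
    (cov_le_axialBoxWeight hM hlam hKq h27 i α pos ℓ hpos _ hcov) hFm hF1

/-- **(II.26)–(II.28) for the Gaussian integration of the fields of the `E_Δ`'s, end to end.** Same setting, each field carrying
the normalisation `(λ_i^t)^{1/2+ε₁}M^{−i}` of (II.26), every box of `Λ` holding `P_i = 2m` fields with `2m = λ^{−ε₁/2}`, and `λ` small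
in the sense `K λ^{3ε₁/4} ≤ e^{−1}`, `K = √2·√(2K_q·4^q·2ζ(q)(2ζ(q/3))³)`: then
`|∫ ∏_n (λ^{1/2+ε₁}M^{−i} φ(v_n))·F dμ ∕ Z| ≤ (e^{−λ^{−ε₁/2}})^{#Λ}` — «Therefore for each box Δ we have a factor
(λ_i^t)^{ε₁P_i}K^{P_i}(P_i/2)! ≤ e^{−(λ_i^t)^{−ε₁/2}} (II.28)». [cite: MagnenRivasseauSeneor1993, §II.B (II.26)–(II.28) pp.335–336] -/
theorem abs_normalised_moment_le_exp_pow_card {C : ℕ → ℕ → ℝ × EuclideanSpace ℝ (Fin 3) → ℝ} {M lam Kq : ℝ}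
    (hM : 0 < M) (hlam : 0 < lam) (hKq : 0 ≤ Kq) {q : ℕ} (hq : 4 ≤ q) (h27 : LargeField.AxialSliceBound C M lam q Kq) (i α : ℕ)
    (A : Matrix S S ℝ) (hA : A.PosDef) (v : W → S → ℝ) (pos : W → Fin 4 → ℝ) (ℓ : W → (Fin 4 → ℤ))
    (hpos : ∀ n, pos n ∈ anisoBox M i α (ℓ n)) (Λ : Finset (Fin 4 → ℤ)) (hΛ : ∀ n, ℓ n ∈ Λ)
    (hcov : ∀ n m, |(A⁻¹ *ᵥ v n) ⬝ᵥ v m| ≤ |C i α (toTS (pos n - pos m))|)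
    {F : (S → ℝ) → ℝ} (hFm : AEStronglyMeasurable F volume) (hF1 : ∀ u, |F u| ≤ 1)
    (ε₁ : ℝ) {m : ℕ} (hocc : ∀ Δ ∈ Λ, occ ℓ Δ = 2 * m) (hP : (2 * m : ℝ) = lam ^ (-(ε₁ / 2)))
    (hsmall : Real.sqrt 2 * Real.sqrt (2 * Kq * (4 ^ q * (2 * T1 q * (2 * T1 (q / 3)) ^ 3))) * lam ^ (3 * ε₁ / 4)
      ≤ Real.exp (-1)) :
    |(∫ u : S → ℝ, (∏ n, (lam ^ (1 / 2 + ε₁) * M ^ (-(i : ℤ)) * u ⬝ᵥ v n)) * F u * weight A u) / ∫ u : S → ℝ, weight A u|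
      ≤ Real.exp (-(lam ^ (-(ε₁ / 2)))) ^ Λ.card := by
  set c : ℝ := lam ^ (1 / 2 + ε₁) * M ^ (-(i : ℤ)) with hc
  have hc0 : 0 ≤ c := by positivity
  have hT : ∀ s : ℝ, 0 ≤ T1 s := fun s => by
    unfold T1
    exact tsum_nonneg fun m => Real.rpow_nonneg (by positivity) _
  have hR : (0 : ℝ) ≤ 4 ^ q * (2 * T1 q * (2 * T1 (q / 3)) ^ 3) := by
    have := hT q; have := hT (q / 3); positivity
  have hX := abs_moment_density_le_localFactorial_boxes hM hlam hKq hq h27 i α A hA v pos ℓ hpos Λ hΛ hcov hFm hF1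
  have key := normalised_le_exp_pow_card ℓ Λ hΛ hM hlam hKq hR i hX hocc hP hsmall
  have hprod : ∀ u : S → ℝ, (∏ n, (c * u ⬝ᵥ v n)) = c ^ Fintype.card W * ∏ n, u ⬝ᵥ v n := fun u => by
    rw [prod_mul_distrib, prod_const, card_univ]
  have hint : (∫ u : S → ℝ, (∏ n, (c * u ⬝ᵥ v n)) * F u * weight A u)
      = c ^ Fintype.card W * ∫ u : S → ℝ, (∏ n, u ⬝ᵥ v n) * F u * weight A u := by
    rw [← integral_const_mul]
    refine integral_congr_ae (ae_of_all _ fun u => ?_)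
    simp only [hprod]
    ring
  rw [hint, mul_div_assoc, abs_mul, abs_of_nonneg (pow_nonneg hc0 _)]
  exact key

end Gaussian

end BoxMatchedDecay

end Literature.MathematicalPhysics.QuantumFieldTheory.MagnenRivasseauSeneor1993
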